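import Literature.NumberTheory.Automorphic.Liu2021.Def411WeilCarriersSurvivalNonsplit
import Literature.NumberTheory.Automorphic.UnitaryGroupSplitPlace
import Literature.NumberTheory.Automorphic.QuadraticLocalBaseChange
import Literature.RepresentationTheory.TwistedCoinvariantsCentralShiftSurvival
import HarnessLib

/-!
# Survival of the unramified vector at the SPLIT places, modulo the spherical structure of the local Weil representation

Topic `NumberTheory/Automorphic`; namespaces `Literature.NumberTheory.Automorphic.UnitaryGroup` (§1: the local torus
`U(J₁)(F_v) ≅ E_wˣ = 𝒪_wˣ · ϖ^ℤ` of a hermitian LINE at a split place) and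
`Literature.NumberTheory.GelbartRogawski1991.UnitaryDualPair.LocalSplitting.FinLocalSplittings` (§2).  KERNEL ONLY:
theorems, 0 definitions, 0 records, 0 named facts, 0 sorry.  Companion of `Def411WeilCarriersSurvivalNonsplit` (the
non-split places).

The survival clause `hS : ∃ S₁, ∀ v ∉ S₁, TwistedCoinv.mk (𝓢.omegaLoc v ∘ localCenter …) χ_{1,v} (unitVec F (Fin N) v) ≠ 0`
of `Def411WeilCarriers.rho_isIrreducible_of_lemD1AsPrinted_of_factors` ([Liu2021, Def. 4.11]'s `⊗'`) at a SPLIT place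
`v` (`c • w ≠ w` for `w ∣ v`): the centre `U(J₁)(F_v) = E_v¹ ≅ E_wˣ` is NOT compact, it is `U(J₁)(𝒪_v) · z₀^ℤ` for a
central «uniformiser» `z₀` (§1, from the tree's split-place isomorphism `localPiSplitEquiv` and a uniformiser of `E_w`),
and the generic SHIFT CRITERION (`TwistedCoinv.mk_ne_zero_of_shift`, tree `TwistedCoinvariantsCentralShiftSurvival`)
reduces survival to ONE local statement about the Weil representation `ω_v`:

  (SPH) the `U(J)(𝒪_v)`-fixed vectors of `ω_v` lie in the span of a linearly independent family `(b_j)_{j ∈ ℤ}` with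
  `b_0 = 1_{𝒪_vᴺ}` and `ω_v(z₀ · 1_N) b_j = b_{j+1}`

— i.e. «the spherical vectors of `ω_v|_{U(J)(F_v)}` at a split unramified place form the free `ℂ[T^{±1}]`-module on the
vacuum» (in the Schrödinger model attached to the eigen-Lagrangian of the split centre these are the indicators of the
balls `ϖ^m 𝒪_vᴺ`; [Liu2021, proof of Lem. D.1, l. 5241–5245]: at a split place `ω` is a unitary induction from
`Q_{n-1,1}`).  (SPH) is NOT proved here: it is the displayed hypothesis `hsph` of §2, stated for every `z₀` admitting the
decomposition of §1 (so that the supplier may use any central uniformiser).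

* §1 `UnitaryGroup.valued_det_eq_one_iff_mem_glInt_one` (`GL₁(𝒪_w) = {g | v_w(det g) = 1}`),
  **`exists_central_uniformiser_of_split`** — at a split place with `J₁ = (j)`, `v_w(j) = 1`: there is
  `z₀ ∈ U(J₁)(F_v)` such that every `h ∈ U(J₁)(F_v)` is `k₀ · z₀ ^ m` with `k₀ ∈ U(J₁)(𝒪_v)`;
  `eventually_forall_placesOver_valued_eq_one` (`v_w(j) = 1` for almost all `v`, all `w ∣ v`).
* §2 **`FinLocalSplittings.eventually_mk_unitVec_ne_zero_of_split`** — for all but finitely many `v`: if `v` is split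
  and (SPH) holds at `v`, then `[1_{𝒪_vᴺ}] ≠ 0` in the `χ_{1,v}`-coinvariants of `ω_v ∘ (local centre)`; with the
  non-split half this is the whole clause `hS` modulo (SPH) at the split places (`exists_finset_mk_unitVec_ne_zero_of_sph`).

## References
* [Liu2021] Y. Liu, Camb. J. Math. 9 (2021) = arXiv:2102.11518, Def. 4.11 (FJcycle.tex l. 2092–2096), Lem. D.1 (l. 5227;
  proof l. 5241–5245).
* [BernsteinZelevinsky1976] I. N. Bernstein, A. V. Zelevinsky, Russian Math. Surveys 31 (1976), §2.3.
* [PlatonovRapinchuk1994] V. Platonov, A. Rapinchuk (1994), §5.1, §6.2.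
* [Mok2014] C. P. Mok, Mem. AMS 235 (2015), §1 Notation p. 5 (`U(N)(F_v) ≅ GL_N(E_w)` for `v` split).
-/

set_option autoImplicit false

noncomputable section

open scoped Matrix
open NumberField IsDedekindDomain Filter Set
open Literature.NumberTheory.Automorphic Literature.NumberTheory.Automorphic.UnitaryGroup
open Literature.NumberTheory.Weil1964 Literature.RepresentationTheory
open Literature.RepresentationTheory.HeisenbergGroup

/-! ## §1 The local torus of a line at a split place: `U(J₁)(F_v) = U(J₁)(𝒪_v) · z₀^ℤ` -/

namespace Literature.NumberTheory.Automorphic.UnitaryGroup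

section SplitTorus

variable {F E : Type} [Field F] [NumberField F] [Field E] [NumberField E] [Algebra F E]
variable (c : E ≃ₐ[F] E) (J₁ : Matrix (Fin 1) (Fin 1) E)

/-- valuation `≤ 1` ↔ membership in the valuation ring `𝒪[E_w]` of the tree's `glInt` (private bridge between Mathlib's
`Valued.v` and the `ValuativeRel` integers). [folklore] -/
private theorem mem_integer_iff_valued_le_one {w : HeightOneSpectrum (𝓞 E)} (x : w.adicCompletion E) :
    x ∈ (ValuativeRel.valuation (w.adicCompletion E)).integer ↔ Valued.v x ≤ 1 := by
  rw [Valuation.mem_integer_iff, ← Valuation.vle_one_iff (ValuativeRel.valuation (w.adicCompletion E)),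
    Valuation.vle_one_iff Valued.v]

omit [NumberField F] [Algebra F E] in
/-- **`GL₁(𝒪_w) = {g ∈ GL₁(E_w) | v_w(det g) = 1}`.** [cite: PlatonovRapinchuk1994, §5.1] -/
theorem valued_det_eq_one_iff_mem_glInt_one {w : HeightOneSpectrum (𝓞 E)} (g : GL (Fin 1) (w.adicCompletion E)) :
    Valued.v ((Matrix.GeneralLinearGroup.det g : (w.adicCompletion E)ˣ) : w.adicCompletion E) = 1 ↔
      g ∈ glInt 1 (w.adicCompletion E) := by
  have hdet : ((Matrix.GeneralLinearGroup.det g : (w.adicCompletion E)ˣ) : w.adicCompletion E) =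
      (g : Matrix (Fin 1) (Fin 1) (w.adicCompletion E)) 0 0 := by
    rw [Matrix.GeneralLinearGroup.val_det_apply, Matrix.det_fin_one]
  have hdet' : (((Matrix.GeneralLinearGroup.det g)⁻¹ : (w.adicCompletion E)ˣ) : w.adicCompletion E) =
      ((g⁻¹ : GL (Fin 1) (w.adicCompletion E)) : Matrix (Fin 1) (Fin 1) (w.adicCompletion E)) 0 0 := by
    rw [← map_inv, Matrix.GeneralLinearGroup.val_det_apply, Matrix.det_fin_one]
  -- `v(det g) * v(det g⁻¹) = 1`
  have hprod : Valued.v ((Matrix.GeneralLinearGroup.det g : (w.adicCompletion E)ˣ) : w.adicCompletion E) *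
      Valued.v (((Matrix.GeneralLinearGroup.det g)⁻¹ : (w.adicCompletion E)ˣ) : w.adicCompletion E) = 1 := by
    rw [← map_mul, Units.mul_inv, map_one]
  rw [mem_glInt_iff]
  constructor
  · intro h
    have h' : Valued.v (((Matrix.GeneralLinearGroup.det g)⁻¹ : (w.adicCompletion E)ˣ) : w.adicCompletion E) = 1 := by
      rwa [h, one_mul] at hprod
    refine ⟨fun i j => ?_, fun i j => ?_⟩
    · obtain rfl : i = 0 := Subsingleton.elim _ _
      obtain rfl : j = 0 := Subsingleton.elim _ _
      exact (mem_integer_iff_valued_le_one _).2 (by rw [← hdet]; exact h.le)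
    · obtain rfl : i = 0 := Subsingleton.elim _ _
      obtain rfl : j = 0 := Subsingleton.elim _ _
      exact (mem_integer_iff_valued_le_one _).2 (by rw [← hdet']; exact h'.le)
  · rintro ⟨h1, h2⟩
    have ha : Valued.v ((Matrix.GeneralLinearGroup.det g : (w.adicCompletion E)ˣ) : w.adicCompletion E) ≤ 1 := by
      rw [hdet]; exact (mem_integer_iff_valued_le_one _).1 (h1 0 0)
    have hb : Valued.v (((Matrix.GeneralLinearGroup.det g)⁻¹ : (w.adicCompletion E)ˣ) : w.adicCompletion E) ≤ 1 := by
      rw [hdet']; exact (mem_integer_iff_valued_le_one _).1 (h2 0 0)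
    refine le_antisymm ha ?_
    -- if `v(det g) < 1` then `v(det g) * v(det g⁻¹) < 1`
    by_contra hlt
    rw [not_le] at hlt
    have : Valued.v ((Matrix.GeneralLinearGroup.det g : (w.adicCompletion E)ˣ) : w.adicCompletion E) *
        Valued.v (((Matrix.GeneralLinearGroup.det g)⁻¹ : (w.adicCompletion E)ˣ) : w.adicCompletion E) < 1 :=
      mul_lt_one_of_lt_of_le hlt hb
    rw [hprod] at this
    exact lt_irrefl _ this

/-- the unit `J₁,w` of the invertible `1 × 1` form at `w` lies in `GL₁(𝒪_w)` when `v_w(j) = 1`, `J₁ = (j)`.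
[cite: PlatonovRapinchuk1994, §5.1] -/
theorem unit_placeForm_mem_glInt_one {w : HeightOneSpectrum (𝓞 E)} (hJw : IsUnit (placeForm J₁ w))
    (hj : Valued.v (algebraMap E (w.adicCompletion E) (J₁ 0 0)) = 1) : hJw.unit ∈ glInt 1 (w.adicCompletion E) := by
  rw [← valued_det_eq_one_iff_mem_glInt_one, Matrix.GeneralLinearGroup.val_det_apply, IsUnit.unit_spec,
    Matrix.det_fin_one]
  exact hj

/-- **Central uniformiser at a split place.**  `E/F` quadratic, `c ≠ 1`, `J₁ = (j)` a hermitian line (`c j = j`) with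
`v_w(j) = 1`, and `w ∣ v` split (`c • w ≠ w`): there is `z₀ ∈ U(J₁)(F_v)` (the element with `w`-component a uniformiser
of `E_w`, through `U(J₁)(F_v) ≃ GL₁(E_w)`) such that EVERY `h ∈ U(J₁)(F_v)` is `k₀ · z₀ ^ m` with `k₀ ∈ U(J₁)(𝒪_v)`,
`m ∈ ℤ` (`E_wˣ = 𝒪_wˣ · ϖ^ℤ`). [cite: Mok2014, §1 Notation p. 5] -/
theorem exists_central_uniformiser_of_split [Algebra.IsQuadraticExtension F E] (hc : c ≠ 1)
    (hJ₁c : (J₁.map c)ᵀ = J₁) {v : HeightOneSpectrum (𝓞 F)} (w : PlacesOver E v) (hw : c • w.1 ≠ w.1)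
    (hj : Valued.v (algebraMap E (w.1.adicCompletion E) (J₁ 0 0)) = 1) :
    ∃ z₀ : localPi E c 1 J₁ v, ∀ h : localPi E c 1 J₁ v,
      ∃ (k₀ : localPi E c 1 J₁ v) (m : ℤ), k₀ ∈ localInt E c 1 J₁ v ∧ h = k₀ * z₀ ^ m := by
  -- the form is invertible at `w` (`v_w(j) = 1` forces `j ≠ 0`)
  have hj0 : algebraMap E (w.1.adicCompletion E) (J₁ 0 0) ≠ 0 := fun h0 => by
    rw [h0, map_zero] at hj; exact zero_ne_one hj
  have hJw : IsUnit (placeForm J₁ w.1) := by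
    rw [Matrix.isUnit_iff_isUnit_det, Matrix.det_fin_one]
    exact isUnit_iff_ne_zero.2 hj0
  have hJi : hJw.unit ∈ glInt 1 (w.1.adicCompletion E) := unit_placeForm_mem_glInt_one J₁ hJw hj
  let e := localPiSplitEquiv c J₁ hc hJ₁c w hw hJw
  -- a uniformiser `π` of `E_w` (a global element of valuation `exp (-1)`), as an element of `GL₁(E_w)`
  obtain ⟨π, hπ⟩ := IsDedekindDomain.HeightOneSpectrum.valuation_exists_uniformizer E w.1
  have hπv : Valued.v (algebraMap E (w.1.adicCompletion E) π) = WithZero.exp (-1 : ℤ) := by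
    rw [show algebraMap E (w.1.adicCompletion E) π = (π : w.1.adicCompletion E) from rfl,
      IsDedekindDomain.HeightOneSpectrum.valuedAdicCompletion_eq_valuation', hπ]
  have hπ0 : algebraMap E (w.1.adicCompletion E) π ≠ 0 := fun h0 => by
    rw [h0, map_zero] at hπv; exact WithZero.exp_ne_zero hπv.symm
  let g₀ : GL (Fin 1) (w.1.adicCompletion E) :=
    Matrix.GeneralLinearGroup.mkOfDetNeZero !![algebraMap E (w.1.adicCompletion E) π]
      (by rw [Matrix.det_fin_one_of]; exact hπ0)
  have hg₀ : Valued.v ((Matrix.GeneralLinearGroup.det g₀ : (w.1.adicCompletion E)ˣ) : w.1.adicCompletion E) =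
      WithZero.exp (-1 : ℤ) := by
    rw [Matrix.GeneralLinearGroup.val_det_apply, Matrix.GeneralLinearGroup.val_mkOfDetNeZero, Matrix.det_fin_one_of]
    exact hπv
  refine ⟨e.symm g₀, fun h => ?_⟩
  -- `v_w(det h_w) = exp m`; then `k₀ := h · z₀ ^ m` is integral and `h = k₀ · z₀ ^ (-m)`
  set x := Valued.v ((Matrix.GeneralLinearGroup.det (e h) : (w.1.adicCompletion E)ˣ) : w.1.adicCompletion E) with hx
  have hx0 : x ≠ 0 := (Valuation.ne_zero_iff _).2 (Units.ne_zero _)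
  set m : ℤ := WithZero.log x with hm
  refine ⟨h * (e.symm g₀) ^ m, -m, ?_, by rw [zpow_neg, mul_inv_cancel_right]⟩
  -- `v_w(det (h_w · π^m)) = exp m · exp(-1)^m = 1`
  have key : e (h * e.symm g₀ ^ m) ∈ glInt 1 (w.1.adicCompletion E) := by
    rw [← valued_det_eq_one_iff_mem_glInt_one, map_mul, map_zpow, ContinuousMulEquiv.apply_symm_apply, map_mul,
      map_zpow, Units.val_mul, Units.val_zpow_eq_zpow_val, map_mul, map_zpow₀, hg₀, ← hx, ← WithZero.exp_log hx0, ← hm,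
      ← WithZero.exp_zsmul, ← WithZero.exp_add, smul_eq_mul, mul_neg_one, add_neg_cancel, WithZero.exp_zero]
  have := (localPiSplitEquiv_symm_mem_localInt_iff c J₁ hc hJ₁c w hw hJw hJi (e (h * e.symm g₀ ^ m))).2 key
  rwa [ContinuousMulEquiv.symm_apply_apply] at this

omit [NumberField F] in
/-- **for almost all `v`, every `w ∣ v` is prime to a given `x ≠ 0`**: `v_w(x) = 1` (finitely many places divide `x` or
`x⁻¹`: Mathlib `HeightOneSpectrum.Support.finite`; finitely many `w` lie over each `v`) — the finiteness behind
«`v ∤ x` for almost all `v`» of the restricted product. [cite: CasselsFrohlichANT1967, Ch. II §16] -/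
theorem eventually_forall_placesOver_valued_eq_one (x : E) (hx : x ≠ 0) :
    ∀ᶠ v : HeightOneSpectrum (𝓞 F) in cofinite, ∀ w : PlacesOver E v,
      Valued.v (algebraMap E (w.1.adicCompletion E) x) = 1 := by
  -- the finite set of places of `E` where `x` or `x⁻¹` is not integral
  have hfin : {w : HeightOneSpectrum (𝓞 E) | ¬ Valued.v (algebraMap E (w.adicCompletion E) x) = 1}.Finite := by
    refine ((IsDedekindDomain.HeightOneSpectrum.Support.finite (𝓞 E) x).union
      (IsDedekindDomain.HeightOneSpectrum.Support.finite (𝓞 E) x⁻¹)).subset fun w hw => ?_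
    simp only [Set.mem_setOf_eq, Set.mem_union, IsDedekindDomain.HeightOneSpectrum.Support] at hw ⊢
    rw [show algebraMap E (w.adicCompletion E) x = (x : w.adicCompletion E) from rfl,
      IsDedekindDomain.HeightOneSpectrum.valuedAdicCompletion_eq_valuation'] at hw
    by_contra hcon
    rw [not_or, not_lt, not_lt, map_inv₀] at hcon
    rcases lt_or_gt_of_ne hw with hlt | hgt
    · have : (w.valuation E x)⁻¹ ≤ 1 := hcon.2
      rw [inv_le_one₀ (zero_lt_iff.2 ((Valuation.ne_zero_iff _).2 hx))] at this
      exact absurd hlt (not_lt.2 this)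
    · exact absurd hgt (not_lt.2 hcon.1)
  -- push forward along `w ↦ v = w ∩ 𝓞_F`
  have himg : {v : HeightOneSpectrum (𝓞 F) | ¬ ∀ w : PlacesOver E v,
      Valued.v (algebraMap E (w.1.adicCompletion E) x) = 1}.Finite := by
    refine (hfin.image (placesOver F E)).subset fun v hv => ?_
    simp only [Set.mem_setOf_eq, not_forall] at hv
    obtain ⟨w, hw⟩ := hv
    exact ⟨w.1, hw, w.2⟩
  exact Filter.eventually_cofinite.2 himg

end SplitTorus

end Literature.NumberTheory.Automorphic.UnitaryGroup

/-! ## §2 Survival at the split places modulo the spherical structure (SPH) -/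

namespace Literature.NumberTheory.GelbartRogawski1991.UnitaryDualPair.LocalSplitting.FinLocalSplittings

variable {F : Type} [Field F] [NumberField F] {E : Type} [Field E] [NumberField E] [Algebra F E]
  [Algebra.IsQuadraticExtension F E] {c : E ≃ₐ[F] E} {N : ℕ} {δ : E} {hcδ : c δ = -δ} {hδ : δ ≠ 0} {d : F}
  {hd : δ * δ = algebraMap F E d} {T : Matrix (Fin N) (Fin N) F} {hT : T.IsSymm}
  {J : Matrix (Fin N) (Fin N) E} {hJ : J = T.map (algebraMap F E)}
  (𝓢 : FinLocalSplittings F E c N hcδ hδ hd T hT hJ) (J₁ : Matrix (Fin 1) (Fin 1) E) (hJ₁ : J₁ 0 0 ≠ 0)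

/-- **Survival of the unramified vector at the SPLIT places, modulo (SPH).**  For a family `𝓢` of local splittings of
`U(J)(F_v)`, a hermitian line `J₁` (`c j = j`, `j ≠ 0`) and a continuous character `χ₁` of the centre: for all but
finitely many `v`, if `v` is split in `E` (`c • w ≠ w` for a `w ∣ v`) and the local Weil representation `ω_v` satisfies the
spherical hypothesis (SPH) — for every central `z₀` with `U(J₁)(F_v) = U(J₁)(𝒪_v) · z₀^ℤ`, the `U(J)(𝒪_v)`-fixed vectors
of `ω_v` lie in the span of a linearly independent family `b : ℤ → 𝒮(F_vᴺ)` with `b 0 = 1_{𝒪_vᴺ}` and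
`ω_v(z₀ · 1_N) (b j) = b (j + 1)` — then the class of `1_{𝒪_vᴺ}` in the `χ_{1,v}`-coinvariants of `ω_v ∘ (u ↦ u · 1_N)` is
NON-ZERO (shift criterion `TwistedCoinv.mk_ne_zero_of_shift`; off a finite set `U(J)(𝒪_v)` fixes `1_{𝒪_vᴺ}`, `χ_{1,v}` is
unramified and `v_w(j) = 1`). [cite: Liu2021, Def. 4.11 (l. 2092–2096)] -/
theorem eventually_mk_unitVec_ne_zero_of_split (hJ₁c : (J₁.map c)ᵀ = J₁) {χ₁ : finAdelicOne F E c →* ℂˣ}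
    (hχ₁ : Continuous χ₁) :
    ∀ᶠ v : HeightOneSpectrum (𝓞 F) in cofinite, ∀ w : PlacesOver E v, c • w.1 ≠ w.1 →
      (∀ z₀ : localPi E c 1 J₁ v,
        (∀ h : localPi E c 1 J₁ v, ∃ (k₀ : localPi E c 1 J₁ v) (m : ℤ), k₀ ∈ localInt E c 1 J₁ v ∧ h = k₀ * z₀ ^ m) →
        ∃ b : ℤ → SchwartzBruhat (Fin N → v.adicCompletion F), b 0 = unitVec F (Fin N) v ∧ LinearIndependent ℂ b ∧
          (∀ j : ℤ, 𝓢.omegaLoc v (localCenter E c N J J₁ hJ₁ v z₀) (b j) = b (j + 1)) ∧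
          (∀ u : SchwartzBruhat (Fin N → v.adicCompletion F),
            (∀ κ ∈ localInt E c N J v, 𝓢.omegaLoc v κ u = u) → u ∈ Submodule.span ℂ (Set.range b))) →
      TwistedCoinv.mk (show Representation ℂ (localPi E c 1 J₁ v) (SchwartzBruhat (Fin N → v.adicCompletion F)) from
          (𝓢.omegaLoc v).comp (localCenter E c N J J₁ hJ₁ v))
        (localCharOfCenter F E c J₁ hJ₁ χ₁ v) (unitVec F (Fin N) v) ≠ 0 := by
  -- `c δ = -δ ≠ 0` forces `c ≠ 1`
  have hc : c ≠ 1 := by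
    rintro rfl
    exact hδ (self_eq_neg.1 (by simpa only [AlgEquiv.one_apply] using hcδ))
  filter_upwards [𝓢.unramified, eventually_localCharOfCenter_eq_one F E c J₁ hJ₁ hχ₁,
    eventually_forall_placesOver_valued_eq_one (F := F) (J₁ 0 0) hJ₁] with v hunr hχv hunit
  intro w hw hsph
  obtain ⟨z₀, hz₀⟩ := exists_central_uniformiser_of_split c J₁ hc hJ₁c w hw (hunit w)
  obtain ⟨b, hb0, hbli, hbT, hbspan⟩ := hsph z₀ hz₀
  rw [← hb0]
  refine TwistedCoinv.mk_ne_zero_of_shift (𝓢.omegaLoc v) (localInt E c N J v) (localCenter E c N J J₁ hJ₁ v)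
    (localCharOfCenter F E c J₁ hJ₁ χ₁ v) z₀ (isCompact_localInt E c N J v) (isOpen_localInt E c N J v)
    (𝓢.isSmooth_omegaLoc v) (fun h => ?_) (fun κ _ => ?_) b hbli hbT (fun κ hκ => ?_) hbspan
  · -- decomposition `h = k₀ · z₀ ^ m` with `k₀ · 1_N ∈ U(J)(𝒪_v)` and `χ_{1,v}(k₀) = 1`
    obtain ⟨k₀, m, hk₀, rfl⟩ := hz₀ h
    exact ⟨k₀, m, localCenter_mapsTo_localInt E c N J J₁ hJ₁ v hk₀, hχv k₀ hk₀, rfl⟩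
  · -- the centre commutes with everything
    exact (Commute.map (localCenter_comm E c N J J₁ hJ₁ v z₀ κ).symm (𝓢.omegaLoc v) : _)
  · -- `1_{𝒪_vᴺ}` is fixed by `U(J)(𝒪_v)`
    rw [hb0]
    exact hunr κ hκ

/-- `Finset` form combining both halves: **the survival clause `hS` modulo (SPH) at the split places** — there is a finite
set `S₀` off which `[1_{𝒪_vᴺ}] ≠ 0` in the central `χ_{1,v}`-coinvariants at every place `v`, PROVIDED (SPH) holds at the
split ones. [cite: Liu2021, Def. 4.11 (l. 2092–2096)] -/
theorem exists_finset_mk_unitVec_ne_zero_of_sph (hJ₁c : (J₁.map c)ᵀ = J₁) {χ₁ : finAdelicOne F E c →* ℂˣ}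
    (hχ₁ : Continuous χ₁)
    (hsph : ∀ᶠ v : HeightOneSpectrum (𝓞 F) in cofinite, ∀ w : PlacesOver E v, c • w.1 ≠ w.1 →
      ∀ z₀ : localPi E c 1 J₁ v,
        (∀ h : localPi E c 1 J₁ v, ∃ (k₀ : localPi E c 1 J₁ v) (m : ℤ), k₀ ∈ localInt E c 1 J₁ v ∧ h = k₀ * z₀ ^ m) →
        ∃ b : ℤ → SchwartzBruhat (Fin N → v.adicCompletion F), b 0 = unitVec F (Fin N) v ∧ LinearIndependent ℂ b ∧
          (∀ j : ℤ, 𝓢.omegaLoc v (localCenter E c N J J₁ hJ₁ v z₀) (b j) = b (j + 1)) ∧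
          (∀ u : SchwartzBruhat (Fin N → v.adicCompletion F),
            (∀ κ ∈ localInt E c N J v, 𝓢.omegaLoc v κ u = u) → u ∈ Submodule.span ℂ (Set.range b))) :
    ∃ S₀ : Finset (HeightOneSpectrum (𝓞 F)), ∀ v : HeightOneSpectrum (𝓞 F), v ∉ S₀ →
      TwistedCoinv.mk (show Representation ℂ (localPi E c 1 J₁ v) (SchwartzBruhat (Fin N → v.adicCompletion F)) from
          (𝓢.omegaLoc v).comp (localCenter E c N J J₁ hJ₁ v))
        (localCharOfCenter F E c J₁ hJ₁ χ₁ v) (unitVec F (Fin N) v) ≠ 0 := by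
  have h := (𝓢.eventually_mk_unitVec_ne_zero_of_nonsplit J₁ hJ₁ hχ₁).and
    ((𝓢.eventually_mk_unitVec_ne_zero_of_split J₁ hJ₁ hJ₁c hχ₁).and hsph)
  rw [Filter.eventually_cofinite] at h
  refine ⟨h.toFinset, fun v hv => ?_⟩
  obtain ⟨hns, hs, hsphv⟩ := not_not.1 fun hm => hv (h.mem_toFinset.2 hm)
  -- a place `w ∣ v` exists; split or not
  obtain ⟨w⟩ := PlacesOver.nonempty E v
  by_cases hw : c • w.1 = w.1
  · exact hns w hw
  · exact hs w hw (hsphv w hw)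

/-! ### Supplier-friendly `∃ z₀` forms (appended) -/

/-- **Survival from ONE central shift with spherical data** (no split hypothesis needed): for all but finitely many `v`,
if SOME `z₀ ∈ U(J₁)(F_v)` with `U(J₁)(F_v) = U(J₁)(𝒪_v) · z₀^ℤ` admits spherical data `b` (as in (SPH)), then the class of
`1_{𝒪_vᴺ}` in the central `χ_{1,v}`-coinvariants is non-zero.  (At a non-split place no such `z₀` exists — the centre is
compact, `b` could not be linearly independent — so this is the split-place statement with the supplier choosing `z₀`.)
[cite: Liu2021, Def. 4.11 (l. 2092–2096)] -/
theorem eventually_mk_unitVec_ne_zero_of_exists_shift {χ₁ : finAdelicOne F E c →* ℂˣ} (hχ₁ : Continuous χ₁) :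
    ∀ᶠ v : HeightOneSpectrum (𝓞 F) in cofinite,
      (∃ z₀ : localPi E c 1 J₁ v,
        (∀ h : localPi E c 1 J₁ v, ∃ (k₀ : localPi E c 1 J₁ v) (m : ℤ), k₀ ∈ localInt E c 1 J₁ v ∧ h = k₀ * z₀ ^ m) ∧
        ∃ b : ℤ → SchwartzBruhat (Fin N → v.adicCompletion F), b 0 = unitVec F (Fin N) v ∧ LinearIndependent ℂ b ∧
          (∀ j : ℤ, 𝓢.omegaLoc v (localCenter E c N J J₁ hJ₁ v z₀) (b j) = b (j + 1)) ∧
          (∀ u : SchwartzBruhat (Fin N → v.adicCompletion F),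
            (∀ κ ∈ localInt E c N J v, 𝓢.omegaLoc v κ u = u) → u ∈ Submodule.span ℂ (Set.range b))) →
      TwistedCoinv.mk (show Representation ℂ (localPi E c 1 J₁ v) (SchwartzBruhat (Fin N → v.adicCompletion F)) from
          (𝓢.omegaLoc v).comp (localCenter E c N J J₁ hJ₁ v))
        (localCharOfCenter F E c J₁ hJ₁ χ₁ v) (unitVec F (Fin N) v) ≠ 0 := by
  filter_upwards [𝓢.unramified, eventually_localCharOfCenter_eq_one F E c J₁ hJ₁ hχ₁] with v hunr hχv
  rintro ⟨z₀, hz₀, b, hb0, hbli, hbT, hbspan⟩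
  rw [← hb0]
  refine TwistedCoinv.mk_ne_zero_of_shift (𝓢.omegaLoc v) (localInt E c N J v) (localCenter E c N J J₁ hJ₁ v)
    (localCharOfCenter F E c J₁ hJ₁ χ₁ v) z₀ (isCompact_localInt E c N J v) (isOpen_localInt E c N J v)
    (𝓢.isSmooth_omegaLoc v) (fun h => ?_) (fun κ _ => ?_) b hbli hbT (fun κ hκ => ?_) hbspan
  · obtain ⟨k₀, m, hk₀, rfl⟩ := hz₀ h
    exact ⟨k₀, m, localCenter_mapsTo_localInt E c N J J₁ hJ₁ v hk₀, hχv k₀ hk₀, rfl⟩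
  · exact (Commute.map (localCenter_comm E c N J J₁ hJ₁ v z₀ κ).symm (𝓢.omegaLoc v) : _)
  · rw [hb0]
    exact hunr κ hκ

/-- `Finset` form with the supplier's `z₀`: **the survival clause `hS` from the non-split half plus, at each split place off a
finite set, ONE central shift with spherical data.** [cite: Liu2021, Def. 4.11 (l. 2092–2096)] -/
theorem exists_finset_mk_unitVec_ne_zero_of_exists_shift {χ₁ : finAdelicOne F E c →* ℂˣ} (hχ₁ : Continuous χ₁)
    (hsph : ∀ᶠ v : HeightOneSpectrum (𝓞 F) in cofinite, ∀ w : PlacesOver E v, c • w.1 ≠ w.1 →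
      ∃ z₀ : localPi E c 1 J₁ v,
        (∀ h : localPi E c 1 J₁ v, ∃ (k₀ : localPi E c 1 J₁ v) (m : ℤ), k₀ ∈ localInt E c 1 J₁ v ∧ h = k₀ * z₀ ^ m) ∧
        ∃ b : ℤ → SchwartzBruhat (Fin N → v.adicCompletion F), b 0 = unitVec F (Fin N) v ∧ LinearIndependent ℂ b ∧
          (∀ j : ℤ, 𝓢.omegaLoc v (localCenter E c N J J₁ hJ₁ v z₀) (b j) = b (j + 1)) ∧
          (∀ u : SchwartzBruhat (Fin N → v.adicCompletion F),
            (∀ κ ∈ localInt E c N J v, 𝓢.omegaLoc v κ u = u) → u ∈ Submodule.span ℂ (Set.range b))) :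
    ∃ S₀ : Finset (HeightOneSpectrum (𝓞 F)), ∀ v : HeightOneSpectrum (𝓞 F), v ∉ S₀ →
      TwistedCoinv.mk (show Representation ℂ (localPi E c 1 J₁ v) (SchwartzBruhat (Fin N → v.adicCompletion F)) from
          (𝓢.omegaLoc v).comp (localCenter E c N J J₁ hJ₁ v))
        (localCharOfCenter F E c J₁ hJ₁ χ₁ v) (unitVec F (Fin N) v) ≠ 0 := by
  have h := (𝓢.eventually_mk_unitVec_ne_zero_of_nonsplit J₁ hJ₁ hχ₁).and
    ((𝓢.eventually_mk_unitVec_ne_zero_of_exists_shift J₁ hJ₁ hχ₁).and hsph)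
  rw [Filter.eventually_cofinite] at h
  refine ⟨h.toFinset, fun v hv => ?_⟩
  obtain ⟨hns, hs, hsphv⟩ := not_not.1 fun hm => hv (h.mem_toFinset.2 hm)
  obtain ⟨w⟩ := PlacesOver.nonempty E v
  by_cases hw : c • w.1 = w.1
  · exact hns w hw
  · exact hs (hsphv w hw)

end Literature.NumberTheory.GelbartRogawski1991.UnitaryDualPair.LocalSplitting.FinLocalSplittings
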